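/-
HONEST FRAMING: certified error envelopes and provably optimal rounding/accumulation schemes for
low-precision formats under stated cost models; every table by two implementations; no hardware
or vendor claims.
-/
import Summits.Ventures.CertifiedArithmetic.LowPrec.OptDemotionRoutingPhi3Arith
import Summits.Ventures.CertifiedArithmetic.LowPrec.OptDemotionRoutingPairNode

/-!
# The demotion law (Theorem T8), part 10i-b: opt's LEMMA Φ3 — FOR EVERY `q`

opt gen 15 §5b, LEMMA Φ3(j,k) (the `a`-side of branch L3 of the two-bit e-side rows R33):

  `x_{k-1} ≤ (1-u) x_k + m · x_(q-k,q-k+j) + u m · x_{q-k+j}`,  `u = 2^-q`, `m = 2^-k`,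
  `2 ≤ j < k ≤ q-1`, `x_T = BR_t({0} ∪ {-p : p ∈ T})`,

for EVERY summation tree and EVERY `q ≥ 4` (`treeBR_phi3`).  opt verified an explicit inductive
certificate (three cases A/B/C with (MC) cascades and R28 chains) in exact arithmetic for
`q ≤ 30`; THIS FILE proves it for all `q` by the tree induction with a TWO-REGIME closed-form
certificate for the hard branch `x₀(a) + 2m x_{q-k+1}(b)` (part 10i-a `phi3_branch0_I/_II`: opt's
option weights `1-u-ε, ε, m, um`, `ε = (m-u)/(1-m)`; on `b` one (MC) row at `q-k+1` and ONE
gap-convexity row of part 10d — `x_{q-k} | x₀, x_j` when `j ≤ q-k`, `x_{q-k+1} | x_{q-k}, x_j` when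
`j ≥ q-k+1` — to which opt's cascades telescope; on `a` one (M) row), the easy branch
`x_{k-1}(a) + u x₀(b)` being the induction hypothesis (`phi3_branch1`); mirrors by the symmetry
of the node; the node rule for the two-bit left-hand side is part 10i-0 `treeBR_pair_node_le`.
Exact cross-check of the whole scheme (both regimes, all `2 ≤ j < k ≤ q-1`, `q = 4..40`, 9139
triples, 0 failures): sessions work/r33/cert_r33.py.  Used by part 10j (R33 for every `q`).
-/

namespace Summit.Ventures.CertifiedArithmetic.LowPrec.Opt

open Literature.ComputerArithmetic.JeannerodRump2018
open Literature.ComputerArithmetic.JeannerodRump2018.SumTree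

section Phi3

variable {q : ℕ}

/-- **opt's LEMMA Φ3 FOR EVERY `q`**: for `q ≥ 4`, `2 ≤ j < k ≤ q - 1` and every tree,
`BR_t{0,-(k-1)} ≤ (1-u) BR_t{0,-k} + 2^-k BR_t{0,-(q-k),-(q-k+j)} + u 2^-k BR_t{0,-(q-k+j)}`. -/
theorem treeBR_phi3 (hq : 4 ≤ q) {j k : ℕ} (hj : 2 ≤ j) (hjk : j < k) (hkq : k + 1 ≤ q) :
    ∀ t : SumTree,
    treeBR q t {0, -((k : ℤ) - 1)} ≤
      (1 - unitRoundoff q) * treeBR q t {0, -(k : ℤ)} +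
        (2 : ℚ) ^ (-(k : ℤ)) * treeBR q t {0, -((q : ℤ) - k), -((q : ℤ) - k + j)} +
          unitRoundoff q * (2 : ℚ) ^ (-(k : ℤ)) * treeBR q t {0, -((q : ℤ) - k + j)} := by
  have hq1 : 1 ≤ q := by omega
  obtain ⟨c, hc⟩ : ∃ c : ℕ, (c : ℤ) = (q : ℤ) - k := ⟨q - k, by omega⟩
  have hc1 : 1 ≤ c := by omega
  have hcq : c + 2 ≤ q := by omega
  rw [← hc]
  set u := unitRoundoff q with hudef
  set m : ℚ := (2 : ℚ) ^ (-(k : ℤ)) with hmdef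
  set t : ℚ := (2 : ℚ) ^ (-(j : ℤ)) with htdef
  ------------------------------------------------------------------ scalar facts
  have huz : u = (2 : ℚ) ^ (-(q : ℤ)) := unitRoundoff_eq_zpow q
  have hu0 : 0 < u := by rw [huz]; exact zpow_pos (by norm_num) _
  have hm0 : 0 < m := zpow_pos (by norm_num) _
  have ht0 : 0 < t := zpow_pos (by norm_num) _
  have two_mul_zpow : ∀ e : ℤ, (2 : ℚ) * (2 : ℚ) ^ e = (2 : ℚ) ^ (e + 1) := fun e => by
    rw [zpow_add_one₀ (by norm_num)]; ring
  have hmu : 2 * u ≤ m := by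
    rw [huz, hmdef, two_mul_zpow]; exact zpow_le_zpow_right₀ (by norm_num) (by omega)
  have htm : 2 * m ≤ t := by
    rw [htdef, hmdef, two_mul_zpow]; exact zpow_le_zpow_right₀ (by norm_num) (by omega)
  have ht4 : t ≤ 1 / 4 := by
    rw [htdef]
    have : (2 : ℚ) ^ (-(j : ℤ)) ≤ (2 : ℚ) ^ (-2 : ℤ) := zpow_le_zpow_right₀ (by norm_num) (by omega)
    have e : (2 : ℚ) ^ (-2 : ℤ) = 1 / 4 := by norm_num
    rwa [e] at this
  have hu1 : u ≤ 1 := unitRoundoff_le_one q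
  -- products of powers
  have pw : ∀ a b : ℤ, (2 : ℚ) ^ a * (2 : ℚ) ^ b = (2 : ℚ) ^ (a + b) := fun a b =>
    (zpow_add₀ (by norm_num) a b).symm
  have hcm : m * (2 : ℚ) ^ (-(c : ℤ)) = u := by rw [hmdef, huz, pw]; congr 1; omega
  have hcjm : m * (2 : ℚ) ^ (-((c : ℤ) + j)) = u * t := by
    rw [hmdef, huz, htdef, pw, pw]; congr 1; omega
  have hmt : m * t = (2 : ℚ) ^ (-((k : ℤ) + j)) := by rw [hmdef, htdef, pw]; congr 1; ring
  have h2m : (2 : ℚ) ^ (-((k : ℤ) - 1)) = 2 * m := by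
    rw [hmdef, two_mul_zpow]; congr 1; ring
  have hc1s : (2 : ℚ) ^ (-((c : ℤ) + 1)) * 2 = (2 : ℚ) ^ (-(c : ℤ)) := by
    rw [mul_comm, two_mul_zpow]; congr 1; ring
  ------------------------------------------------------------------ per-child rows
  have n0 : ∀ (X : SumTree) (S : Finset ℤ), 0 ≤ treeBR q X S := fun X S => treeBR_nonneg q X S
  have rTriple : Routable q ({0, -(j : ℤ), -(k : ℤ)} : Finset ℤ) := by
    intro x hx y hy
    simp only [Finset.mem_insert, Finset.mem_singleton] at hx hy
    rcases hx with rfl | rfl | rfl <;> rcases hy with rfl | rfl | rfl <;> omega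
  have rowM0 : ∀ X : SumTree, 0 ≤ (-1) * treeBR q X {0} + (1) * treeBR q X {0, -(c : ℤ)} := by
    intro X
    have h := treeBR_le_of_subset hq1 X (B := ({0} : Finset ℤ)) (C := ({0, -(c : ℤ)} : Finset ℤ))
      (by intro z hz; rw [Finset.mem_singleton] at hz; simp [hz]) (routable_zero_pair (by omega) (by omega))
    linarith only [h]
  have rowMC : ∀ X : SumTree, 0 ≤ (-2) * treeBR q X {0, -((c : ℤ) + 1)} + (1) * treeBR q X {0, -(c : ℤ)} +
      (1) * treeBR q X {0} := by
    intro X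
    have h := two_treeBR_pair_le (q := q) X (e := -((c : ℤ) + 1)) (by omega) (by omega)
    rw [show -((c : ℤ) + 1) + 1 = -(c : ℤ) by ring] at h
    linarith only [h]
  have rowMj : ∀ X : SumTree, 0 ≤ (-1) * treeBR q X {0, -(j : ℤ)} + (1) * treeBR q X {0, -(j : ℤ), -(k : ℤ)} := by
    intro X
    have h := treeBR_le_of_subset hq1 X (B := ({0, -(j : ℤ)} : Finset ℤ)) (C := ({0, -(j : ℤ), -(k : ℤ)} : Finset ℤ))
      (by
        intro z hz
        simp only [Finset.mem_insert, Finset.mem_singleton] at hz ⊢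
        rcases hz with h | h
        · exact Or.inl h
        · exact Or.inr (Or.inl h)) rTriple
    linarith only [h]
  have rowM0j : ∀ X : SumTree, 0 ≤ (-1) * treeBR q X {0} + (1) * treeBR q X {0, -(j : ℤ), -(k : ℤ)} := by
    intro X
    have h := treeBR_le_of_subset hq1 X (B := ({0} : Finset ℤ)) (C := ({0, -(j : ℤ), -(k : ℤ)} : Finset ℤ))
      (by intro z hz; rw [Finset.mem_singleton] at hz; simp [hz]) rTriple
    linarith only [h]
  -- regime I: gap convexity x_c | x_0, x_j (j ≤ c), scaled by m
  have rowGC0 : j ≤ c → ∀ X : SumTree, 0 ≤ (-m*t) * treeBR q X {0, -(c : ℤ)} + (m*t - u) * treeBR q X {0} +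
      (u) * treeBR q X {0, -(j : ℤ)} := by
    intro hjc X
    have h := treeBR_gc0_pair (q := q) X (j := j) (c := c) (by omega) hjc (by omega)
    rw [← htdef] at h
    have h' := mul_le_mul_of_nonneg_left h hm0.le
    have e1 : m * (t * treeBR q X {0, -(c : ℤ)}) = m * t * treeBR q X {0, -(c : ℤ)} := by ring
    have e2 : m * ((t - (2 : ℚ) ^ (-(c : ℤ))) * treeBR q X {0} + (2 : ℚ) ^ (-(c : ℤ)) * treeBR q X {0, -(j : ℤ)}) =
        (m * t - m * (2 : ℚ) ^ (-(c : ℤ))) * treeBR q X {0} + (m * (2 : ℚ) ^ (-(c : ℤ))) * treeBR q X {0, -(j : ℤ)} := by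
      ring
    rw [e1, e2, hcm] at h'
    linarith only [h']
  -- regime II: gap convexity x_{c+1} | x_c, x_j (c + 1 ≤ j), scaled by 2m
  have rowGC : c + 1 ≤ j → ∀ X : SumTree, 0 ≤ (2*m*t - 2*u) * treeBR q X {0, -((c : ℤ) + 1)} +
      (-2*m*t + u) * treeBR q X {0, -(c : ℤ)} + (u) * treeBR q X {0, -(j : ℤ)} := by
    intro hcj X
    have h := treeBR_gc_pair (q := q) X (j := j) (c := c) hc1 hcj (by omega)
    rw [← htdef] at h
    have h' := mul_le_mul_of_nonneg_left h (by positivity : (0 : ℚ) ≤ 2 * m)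
    have es : 2 * m * (2 : ℚ) ^ (-(c : ℤ)) = 2 * u := by rw [mul_assoc, hcm]
    have es1 : 2 * m * (2 : ℚ) ^ (-((c : ℤ) + 1)) = u := by
      rw [← hcm, ← hc1s]; ring
    have e1 : 2 * m * (((2 : ℚ) ^ (-(c : ℤ)) - t) * treeBR q X {0, -((c : ℤ) + 1)}) =
        (2 * m * (2 : ℚ) ^ (-(c : ℤ)) - 2 * m * t) * treeBR q X {0, -((c : ℤ) + 1)} := by ring
    have e2 : 2 * m * ((((2 : ℚ) ^ (-((c : ℤ) + 1))) - t) * treeBR q X {0, -(c : ℤ)} +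
        ((2 : ℚ) ^ (-(c : ℤ)) - (2 : ℚ) ^ (-((c : ℤ) + 1))) * treeBR q X {0, -(j : ℤ)}) =
        (2 * m * (2 : ℚ) ^ (-((c : ℤ) + 1)) - 2 * m * t) * treeBR q X {0, -(c : ℤ)} +
          (2 * m * (2 : ℚ) ^ (-(c : ℤ)) - 2 * m * (2 : ℚ) ^ (-((c : ℤ) + 1))) * treeBR q X {0, -(j : ℤ)} := by ring
    rw [e1, e2, es, es1] at h'
    linarith only [h']
  -- regime II: (M) x_j ≤ x_c for c + 1 ≤ j
  have rowMjq : c + 1 ≤ j → ∀ X : SumTree, 0 ≤ (-1) * treeBR q X {0, -(j : ℤ)} + (1) * treeBR q X {0, -(c : ℤ)} := by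
    intro hcj X
    have h := treeBR_mono hq1 X (S := ({0, -(j : ℤ)} : Finset ℤ)) (S' := ({0, -(c : ℤ)} : Finset ℤ))
      (Finset.insert_nonempty _ _) (Finset.insert_nonempty _ _) (routable_zero_pair (by omega) (by omega))
      (routable_zero_pair (by omega) (by omega)) (by
        rw [val_pair (by omega), val_pair (by omega)]
        have : (2 : ℚ) ^ (-(j : ℤ)) ≤ (2 : ℚ) ^ (-(c : ℤ)) := zpow_le_zpow_right₀ (by norm_num) (by omega)
        linarith only [this])
    linarith only [h]
  -- options at a node (lower bounds of the right-hand node values)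
  have optK : ∀ A B : SumTree,
      1 + ((1) * treeBR q A {0, -(k : ℤ)} + (u) * treeBR q B {0}) ≤ treeBR q (.node A B) {0, -(k : ℤ)} ∧
      1 + ((1) * treeBR q A {0} + (m) * treeBR q B {0, -(c : ℤ)}) ≤ treeBR q (.node A B) {0, -(k : ℤ)} := by
    intro A B
    obtain ⟨s1, s2⟩ := treeBR_pair_node_ge hq1 A B (i := k) (by omega) (by omega)
    have e1 : treeBR q B {-(q : ℤ)} = u * treeBR q B {0} := by rw [treeBR_single_shift, huz]
    have e2 : treeBR q B {-(k : ℤ), -(q : ℤ)} = m * treeBR q B {0, -(c : ℤ)} := by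
      rw [hmdef, ← treeBR_pair_shift B (-(k : ℤ)) (-(c : ℤ))]; congr 1; ext z; simp; omega
    rw [e1] at s1; rw [e2] at s2
    exact ⟨by linarith only [s1], by linarith only [s2]⟩
  have optP : ∀ A B : SumTree,
      1 + ((1) * treeBR q A {0, -(c : ℤ), -((c : ℤ) + j)} + (u) * treeBR q B {0}) ≤
        treeBR q (.node A B) {0, -(c : ℤ), -((c : ℤ) + j)} ∧
      (m) + ((m) * treeBR q A {0} + (u) * treeBR q B {0, -(j : ℤ), -(k : ℤ)}) ≤
        (m) * treeBR q (.node A B) {0, -(c : ℤ), -((c : ℤ) + j)} := by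
    intro A B
    obtain ⟨s1, -, -, s4⟩ := treeBR_triple_node_ge hq1 A B (a := c) (b := c + j) hc1 (by omega) (by omega)
    have e0 : ({0, -(c : ℤ), -((c + j : ℕ) : ℤ)} : Finset ℤ) = {0, -(c : ℤ), -((c : ℤ) + j)} := by
      push_cast; rfl
    rw [e0] at s1 s4
    have e1 : treeBR q B {-(q : ℤ)} = u * treeBR q B {0} := by rw [treeBR_single_shift, huz]
    have e2 : treeBR q B {-(c : ℤ), -((c + j : ℕ) : ℤ), -(q : ℤ)} =
        (2 : ℚ) ^ (-(c : ℤ)) * treeBR q B {0, -(j : ℤ), -(k : ℤ)} := by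
      rw [← treeBR_triple_shift B (-(c : ℤ)) (-(j : ℤ)) (-(k : ℤ))]; congr 1; ext z; simp; omega
    rw [e1] at s1; rw [e2] at s4
    refine ⟨by linarith only [s1], ?_⟩
    have s4' := mul_le_mul_of_nonneg_left s4 hm0.le
    have e3 : m * (1 + (treeBR q A {0} + (2 : ℚ) ^ (-(c : ℤ)) * treeBR q B {0, -(j : ℤ), -(k : ℤ)})) =
        m + (m * treeBR q A {0} + (m * (2 : ℚ) ^ (-(c : ℤ))) * treeBR q B {0, -(j : ℤ), -(k : ℤ)}) := by ring
    rw [e3, hcm] at s4'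
    linarith only [s4']
  have optQ : ∀ A B : SumTree,
      1 + ((1) * treeBR q A {0, -((c : ℤ) + j)} + (u) * treeBR q B {0}) ≤ treeBR q (.node A B) {0, -((c : ℤ) + j)} ∧
      (m) + ((m) * treeBR q A {0} + (u*t) * treeBR q B {0, -((k : ℤ) - j)}) ≤
        (m) * treeBR q (.node A B) {0, -((c : ℤ) + j)} := by
    intro A B
    obtain ⟨s1, s2⟩ := treeBR_pair_node_ge hq1 A B (i := c + j) (by omega) (by omega)
    have e0 : ({0, -((c + j : ℕ) : ℤ)} : Finset ℤ) = {0, -((c : ℤ) + j)} := by push_cast; rfl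
    rw [e0] at s1 s2
    have e1 : treeBR q B {-(q : ℤ)} = u * treeBR q B {0} := by rw [treeBR_single_shift, huz]
    have e2 : treeBR q B {-((c + j : ℕ) : ℤ), -(q : ℤ)} =
        (2 : ℚ) ^ (-((c : ℤ) + j)) * treeBR q B {0, -((k : ℤ) - j)} := by
      rw [← treeBR_pair_shift B (-((c : ℤ) + j)) (-((k : ℤ) - j))]; congr 1; ext z; simp; omega
    rw [e1] at s1; rw [e2] at s2
    refine ⟨by linarith only [s1], ?_⟩
    have s2' := mul_le_mul_of_nonneg_left s2 hm0.le
    have e3 : m * (1 + (treeBR q A {0} + (2 : ℚ) ^ (-((c : ℤ) + j)) * treeBR q B {0, -((k : ℤ) - j)})) =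
        m + (m * treeBR q A {0} + (m * (2 : ℚ) ^ (-((c : ℤ) + j))) * treeBR q B {0, -((k : ℤ) - j)}) := by ring
    rw [e3, hcjm] at s2'
    linarith only [s2']
  -- symmetry of the node
  have comm : ∀ (A B : SumTree) (S : Finset ℤ), treeBR q (.node B A) S = treeBR q (.node A B) S :=
    fun A B S => by unfold treeBR; exact treeBRw_node_comm q _ B A S
  ------------------------------------------------------------------ the induction
  intro tr
  induction tr with
  | leaf z => simp [treeBR]
  | node A B ihA ihB =>
    set NK := treeBR q (.node A B) {0, -(k : ℤ)} with hNK
    set NP := treeBR q (.node A B) {0, -(c : ℤ), -((c : ℤ) + j)} with hNP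
    set NQ := treeBR q (.node A B) {0, -((c : ℤ) + j)} with hNQ
    obtain ⟨oK0ab, oK1ab⟩ := optK A B
    obtain ⟨oK0ba, oK1ba⟩ := optK B A
    obtain ⟨oP0ab, oPSab⟩ := optP A B
    obtain ⟨oP0ba, oPSba⟩ := optP B A
    obtain ⟨oQ0ab, oQSab⟩ := optQ A B
    obtain ⟨oQ0ba, oQSba⟩ := optQ B A
    rw [comm] at oK0ba oK1ba oP0ba oPSba oQ0ba oQSba
    -- the induction hypotheses as rows
    have ihA' : 0 ≤ (-1) * treeBR q A {0, -((k : ℤ) - 1)} + (1 - u) * treeBR q A {0, -(k : ℤ)} +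
        (m) * treeBR q A {0, -(c : ℤ), -((c : ℤ) + j)} + (u*m) * treeBR q A {0, -((c : ℤ) + j)} := by
      linarith only [ihA]
    have ihB' : 0 ≤ (-1) * treeBR q B {0, -((k : ℤ) - 1)} + (1 - u) * treeBR q B {0, -(k : ℤ)} +
        (m) * treeBR q B {0, -(c : ℤ), -((c : ℤ) + j)} + (u*m) * treeBR q B {0, -((c : ℤ) + j)} := by
      linarith only [ihB]
    -- R ≥ 0
    have hR : 0 ≤ (1 - u) * NK + (m) * NP + (u*m) * NQ - 1 := by
      have h1 : 1 ≤ NK := by linarith only [oK0ab, n0 A {0, -(k : ℤ)}, mul_nonneg hu0.le (n0 B {0})]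
      have h2 : 1 ≤ NP := by
        linarith only [oP0ab, n0 A {0, -(c : ℤ), -((c : ℤ) + j)}, mul_nonneg hu0.le (n0 B {0})]
      have h3 : 0 ≤ (u*m) * NQ := mul_nonneg (mul_nonneg hu0.le hm0.le) (n0 _ _)
      have h4 := mul_le_mul_of_nonneg_left h1 (by linarith only [hu1] : (0 : ℚ) ≤ 1 - u)
      have h5 := mul_le_mul_of_nonneg_left h2 hm0.le
      linarith only [h3, h4, h5, hmu, hu0]
    have hb : ((k - 1 : ℕ) : ℤ) = (k : ℤ) - 1 := by omega
    have key := treeBR_pair_node_le hq1 A B (i := k - 1) (by omega) (by omega) hR ?_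
    · rw [hb] at key; linarith only [key]
    rw [hb]
    -- shifts of the raw option expressions
    have eq1 : ∀ X : SumTree, treeBR q X {-(q : ℤ)} = u * treeBR q X {0} := fun X => by
      rw [treeBR_single_shift, huz]
    have eq2 : ∀ X : SumTree, treeBR q X {-((k : ℤ) - 1), -(q : ℤ)} = 2 * m * treeBR q X {0, -((c : ℤ) + 1)} := fun X => by
      rw [← h2m, ← treeBR_pair_shift X (-((k : ℤ) - 1)) (-((c : ℤ) + 1))]; congr 1; ext z; simp; omega
    rw [eq1, eq1, eq2, eq2]
    -- branch 1 (both orientations)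
    have b1 := phi3_branch1 hu0 hmu htm ht4 oK0ab oP0ab oQ0ab ihA' (n0 B {0})
    have b1' := phi3_branch1 hu0 hmu htm ht4 oK0ba oP0ba oQ0ba ihB' (n0 A {0})
    -- branch 0 (both orientations), by regime
    have b0 : 1 + (treeBR q A {0} + 2 * m * treeBR q B {0, -((c : ℤ) + 1)}) ≤ (1 - u) * NK + (m) * NP + (u*m) * NQ ∧
        1 + (treeBR q B {0} + 2 * m * treeBR q A {0, -((c : ℤ) + 1)}) ≤ (1 - u) * NK + (m) * NP + (u*m) * NQ := by
      rcases Nat.lt_or_ge c j with hlt | hge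
      · -- regime II: c + 1 ≤ j, i.e. 2 m t ≤ u
        have hII : 2 * (m * t) ≤ u := by
          rw [hmt, huz, two_mul_zpow]; exact zpow_le_zpow_right₀ (by norm_num) (by omega)
        exact ⟨phi3_branch0_II hu0 hmu htm ht4 hII oK1ab oK1ba oPSab oQSba (rowM0 A) (rowMj B) (rowMC B)
            (rowGC hlt B) (rowMjq hlt B) (n0 A _),
          phi3_branch0_II hu0 hmu htm ht4 hII oK1ba oK1ab oPSba oQSab (rowM0 B) (rowMj A) (rowMC A)
            (rowGC hlt A) (rowMjq hlt A) (n0 B _)⟩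
      · -- regime I: j ≤ c, i.e. u ≤ m t
        have hI : u ≤ m * t := by
          rw [hmt, huz]; exact zpow_le_zpow_right₀ (by norm_num) (by omega)
        exact ⟨phi3_branch0_I hu0 hmu htm ht4 hI oK1ab oK1ba oPSab oQSba (rowM0 A) (rowMC B) (rowGC0 hge B)
            (rowMj B) (rowM0j B) (n0 A _),
          phi3_branch0_I hu0 hmu htm ht4 hI oK1ba oK1ab oPSba oQSab (rowM0 B) (rowMC A) (rowGC0 hge A)
            (rowMj A) (rowM0j A) (n0 B _)⟩
    obtain ⟨b0ab, b0ba⟩ := b0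
    refine max_le (max_le ?_ ?_) (max_le ?_ ?_)
    · linarith only [b1]
    · linarith only [b0ab]
    · linarith only [b1']
    · linarith only [b0ba]

end Phi3

end Summit.Ventures.CertifiedArithmetic.LowPrec.Opt
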